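import Literature.MathematicalPhysics.QuantumLattice.TorusCooperSumRowWalk
import Literature.MathematicalPhysics.QuantumLattice.TorusCooperSumLogBound
import Literature.MathematicalPhysics.QuantumLattice.BdGModeGainBound
import HarnessLib

/-!
# The BdG mode gain from below and the Cooper row walk at the temperature cutoff

Topic `MathematicalPhysics/QuantumLattice`; pure real-analysis continuation of
`BdGModeGainBound.lean` (UPPER bounds `bdgModeGain_le` for the per-mode gain
`log((1 + cosh βE)/2) - log((1 + cosh βξ)/2)`, `E = √(ξ² + D²)`, of the BdG pressure of
`DWaveSourceFreePressure.lean`) and of `TorusCooperSumRowWalk.lean` / `TorusCooperSumLogBound.lean`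
(the harmonic walk `cooperRow_sum_ge` along one row of the momentum grid at the level-spacing cutoff
`1/L`, and the good-row count `card_cooperGoodRows_ge`). Here we PROVE the matching LOWER bounds that
produce the free `d`-wave Cooper logarithm `∂²_h p ≳ log β` of the sourced torus at temperature
`1/β` (used by the summit file `Summits/HubbardSuperconductivity/…/Theorems/
ThermalWedgeTwSourcedCondensationFreeLinearCooperLog.lean`):

* `cosh_le_three_mul_sinh` — `tanh a ≥ 1/3` for `a ≥ 1/2` (only `e ≥ 2` is used);
* `cosh_mul_one_add_le_cosh_add`, `div_le_two_mul_log_cosh_sub` — `cosh(a+t) ≥ cosh a (1 + t/3)`,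
  hence `2(log cosh(a+t) - log cosh a) ≥ 2t/(3+t)` (`a ≥ 1/2`, `t ≥ 0`);
* **`bdgModeGain_ge`** — a mode with `β|ξ| ≥ 1`, `D² ≤ 35ξ²`, `βD² ≤ 35|ξ|` gains at least the
  Cooper amount `βD²/(40|ξ|)` (with `a = β|ξ|/2`, `t = β(E - |ξ|)/2 ∈ [βD²/(14|ξ|), 5/2]`);
* **`cooperRow_weighted_sum_ge`** — the harmonic walk at the TEMPERATURE cutoff `1/β` instead of
  `1/L`: along a good row `g(n) = -2cos(2πn/L) + c`, `|c| ≤ 2 - s²/2`, a non-negative `F` with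
  `F(n) ≥ A/g(n)` on `1/β < g(n) ≤ φ` has `Σ_{n<L} F(n) ≥ A (L/(8π)) (log β - log(128/s³))`
  (`β ≥ 128/s³`, `L ≥ β`, `L ≥ 400/s²`, `L ≥ 8π/φ`, `s² ≤ 2φ`);
* **`card_cooperGoodRows_dWave_ge`** — for `μ ∈ [-4 + d₀, -d₀]` at least `d₀L/(32π)` rows cross the
  Fermi level transversally AND keep the `d`-wave margin `|2cos(2πn/L) + μ/2| ≥ φ₀`
  (`card_cooperGoodRows_ge` with an extra strip around the node of `cos k₁ - cos k₂` removed).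

Folklore calculus behind M. Salmhofer, *Renormalization: An Introduction* (Springer 1999) §4.5.4,
(4.200)–(4.203) [Salmhofer1999] (the Cooper logarithm `½N(0) log(βε₀/2)`, here from BELOW and with the
`d_{x²-y²}` weight); constants are not optimised. No definition, no named fact; no torus object appears.
-/

noncomputable section

namespace Literature.MathematicalPhysics.QuantumLattice

open Real Finset

/-! ### Hyperbolic lower bounds -/

/-- `cosh a ≤ 3 sinh a` for `a ≥ 1/2`, i.e. `tanh a ≥ 1/3` there (from `e^{2a} ≥ e ≥ 2`). [folklore] -/
theorem cosh_le_three_mul_sinh {a : ℝ} (ha : 1 / 2 ≤ a) : Real.cosh a ≤ 3 * Real.sinh a := by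
  rw [Real.cosh_eq, Real.sinh_eq]
  have hu : Real.exp (1 / 2) ≤ Real.exp a := Real.exp_le_exp.2 ha
  have hv : Real.exp (-a) ≤ Real.exp (-(1 / 2)) := Real.exp_le_exp.2 (by linarith)
  have he : (2 : ℝ) ≤ Real.exp 1 := by linarith [Real.add_one_le_exp (1 : ℝ)]
  have hsq : Real.exp (1 / 2) * Real.exp (1 / 2) = Real.exp 1 := by rw [← Real.exp_add]; norm_num
  have hinv : Real.exp (-(1 / 2)) * Real.exp (1 / 2) = 1 := by rw [← Real.exp_add]; norm_num
  have hp : 0 < Real.exp (1 / 2) := Real.exp_pos _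
  have hq : 0 < Real.exp (-(1 / 2)) := Real.exp_pos _
  have h2 : 2 * Real.exp (-(1 / 2)) ≤ Real.exp (1 / 2) := by nlinarith
  linarith

/-- `cosh a · (1 + t/3) ≤ cosh(a + t)` for `a ≥ 1/2`, `t ≥ 0` (addition formula, `cosh t ≥ 1`,
`sinh t ≥ t`, `sinh a ≥ cosh a/3`). [folklore] -/
theorem cosh_mul_one_add_le_cosh_add {a t : ℝ} (ha : 1 / 2 ≤ a) (ht : 0 ≤ t) :
    Real.cosh a * (1 + t / 3) ≤ Real.cosh (a + t) := by
  rw [Real.cosh_add]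
  have h1 : 1 ≤ Real.cosh t := Real.one_le_cosh t
  have h2 : t ≤ Real.sinh t := Real.self_le_sinh_iff.2 ht
  have h3 := cosh_le_three_mul_sinh ha
  have h4 : 0 < Real.cosh a := Real.cosh_pos a
  have h5 : 0 ≤ Real.sinh a := by linarith
  nlinarith [mul_le_mul_of_nonneg_left h1 h4.le, mul_le_mul_of_nonneg_left h2 h5,
    mul_le_mul_of_nonneg_right h3 ht]

/-- `2t/(3 + t) ≤ 2(log cosh(a + t) - log cosh a)` for `a ≥ 1/2`, `t ≥ 0`
(`log y ≥ 1 - 1/y` at `y = 1 + t/3 ≤ cosh(a+t)/cosh a`). [folklore] -/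
theorem div_le_two_mul_log_cosh_sub {a t : ℝ} (ha : 1 / 2 ≤ a) (ht : 0 ≤ t) :
    2 * t / (3 + t) ≤ 2 * (Real.log (Real.cosh (a + t)) - Real.log (Real.cosh a)) := by
  have hca := Real.cosh_pos a
  have hcb := Real.cosh_pos (a + t)
  have hy : 0 < 1 + t / 3 := by positivity
  have hq : 1 + t / 3 ≤ Real.cosh (a + t) / Real.cosh a := by
    rw [le_div_iff₀ hca, mul_comm]
    exact cosh_mul_one_add_le_cosh_add ha ht
  have hlog : Real.log (1 + t / 3) ≤ Real.log (Real.cosh (a + t)) - Real.log (Real.cosh a) := by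
    rw [← Real.log_div hcb.ne' hca.ne']
    exact Real.log_le_log hy hq
  have hlow : 1 - (1 + t / 3)⁻¹ ≤ Real.log (1 + t / 3) := Real.one_sub_inv_le_log_of_pos hy
  have e : 1 - (1 + t / 3)⁻¹ = t / (3 + t) := by
    field_simp
    ring
  have e2 : 2 * t / (3 + t) = 2 * (t / (3 + t)) := by ring
  rw [e2]
  rw [e] at hlow
  linarith

/-! ### The per-mode gain of the BdG pressure from below -/

/-- **Per-mode Cooper gain of the BdG pressure (lower bound).** For `β > 0`, `β|ξ| ≥ 1`,
`D² ≤ 35ξ²` and `βD² ≤ 35|ξ|`: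
`βD²/(40|ξ|) ≤ log((1 + cosh(β√(ξ²+D²)))/2) - log((1 + cosh(βξ))/2)`.
(With `a = β|ξ|/2 ≥ 1/2`, `t = β(E - |ξ|)/2 ∈ [βD²/(14|ξ|), 5/2]` since `|ξ| ≤ E ≤ 6|ξ|`; then
`2(log cosh(a+t) - log cosh a) ≥ 2t/(3+t)`.) [folklore] -/
theorem bdgModeGain_ge {β ξ D : ℝ} (hβ : 0 < β) (hξ : 1 ≤ β * |ξ|) (hD1 : D ^ 2 ≤ 35 * ξ ^ 2)
    (hD2 : β * D ^ 2 ≤ 35 * |ξ|) :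
    β * D ^ 2 / (40 * |ξ|) ≤ Real.log ((1 + Real.cosh (β * Real.sqrt (ξ ^ 2 + D ^ 2))) / 2) -
        Real.log ((1 + Real.cosh (β * ξ)) / 2) := by
  set E := Real.sqrt (ξ ^ 2 + D ^ 2) with hE
  have hE0 : 0 ≤ E := Real.sqrt_nonneg _
  have hEsq : E ^ 2 = ξ ^ 2 + D ^ 2 := Real.sq_sqrt (by positivity)
  have hξpos : 0 < |ξ| := by
    rcases (abs_nonneg ξ).eq_or_lt with h0 | h0
    · rw [← h0, mul_zero] at hξ; linarith
    · exact h0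
  have hξE : |ξ| ≤ E := by
    rw [hE, ← Real.sqrt_sq_eq_abs]
    exact Real.sqrt_le_sqrt (by nlinarith [sq_nonneg D])
  have hE6 : E ≤ 6 * |ξ| := by
    have h36 : E ^ 2 ≤ (6 * |ξ|) ^ 2 := by
      rw [hEsq, mul_pow, sq_abs]; nlinarith
    exact (pow_le_pow_iff_left₀ hE0 (by positivity) two_ne_zero).1 h36
  have hcosh_abs : Real.cosh (β * ξ) = Real.cosh (β * |ξ|) := by
    rw [← Real.cosh_abs (β * ξ), abs_mul, abs_of_pos hβ]
  rw [hcosh_abs, log_one_add_cosh_div_two, log_one_add_cosh_div_two]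
  set a := β * |ξ| / 2 with ha
  set t := β * E / 2 - a with ht
  have hbt : β * E / 2 = a + t := by ring
  have ha2 : 1 / 2 ≤ a := by rw [ha]; linarith
  have ht0 : 0 ≤ t := by
    rw [ht, ha]
    nlinarith [mul_le_mul_of_nonneg_left hξE hβ.le]
  have habs2 : |ξ| ^ 2 = ξ ^ 2 := sq_abs ξ
  have htprod : t * (E + |ξ|) = β * D ^ 2 / 2 := by
    rw [ht, ha]
    linear_combination (β / 2) * hEsq - (β / 2) * habs2
  have htlow : β * D ^ 2 / (14 * |ξ|) ≤ t := by
    rw [div_le_iff₀ (by positivity)]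
    nlinarith [mul_le_mul_of_nonneg_left (add_le_add_right hE6 |ξ|) ht0]
  have htlow_le : β * D ^ 2 / (14 * |ξ|) ≤ 5 / 2 := by
    rw [div_le_iff₀ (by positivity)]
    nlinarith
  rw [hbt, ← mul_sub]
  refine le_trans ?_ (div_le_two_mul_log_cosh_sub ha2 ht0)
  set tl := β * D ^ 2 / (14 * |ξ|) with htl
  have htl0 : 0 ≤ tl := by positivity
  calc β * D ^ 2 / (40 * |ξ|) = (14 * tl) / 40 := by
        rw [htl]
        field_simp
    _ ≤ 2 * tl / (3 + tl) := by
        rw [div_le_div_iff₀ (by norm_num) (by positivity)]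
        nlinarith [mul_nonneg htl0 (sub_nonneg.2 htlow_le)]
    _ ≤ 2 * t / (3 + t) := by
        rw [div_le_div_iff₀ (by positivity) (by positivity)]
        nlinarith

/-! ### The harmonic walk at the temperature cutoff -/

/-- **The weighted harmonic walk along one good row at the temperature cutoff `1/β`.** Let
`g(n) = -2cos(2πn/L) + c` with `|c| ≤ 2 - s²/2` (`0 < s ≤ 1`), `L ≥ 400/s²`, `β ≥ 128/s³`, `L ≥ β`,
`s² ≤ 2φ`, `L ≥ 8π/φ`. If `F ≥ 0` and `F(n) ≥ A/g(n)` for every `n < L` with `1/β < g(n) ≤ φ`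
(`A ≥ 0`), then `Σ_{n<L} F(n) ≥ A (L/(8π)) (log β - log(128/s³))`: to the right of the crossing `n₀`
(`exists_cooperRow_crossing`) the energies `g(n₀ + j)`, `L/(sβ) < j ≤ s²L/64`, lie in
`(1/β, min(φ, 8πj/L)]` (`cooperRow_walk_bounds`), and `Σ 1/j ≥ log(s²L/64) - log(2L/(sβ))`. [folklore] -/
theorem cooperRow_weighted_sum_ge {L : ℕ} {s c β φ A : ℝ} (g F : ℕ → ℝ)
    (hg : ∀ n : ℕ, g n = -2 * Real.cos (2 * π * (n : ℝ) / L) + c) (hs : 0 < s) (hs1 : s ≤ 1)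
    (hc : |c| ≤ 2 - s ^ 2 / 2) (hL : 400 / s ^ 2 ≤ (L : ℝ)) (hβ : 128 / s ^ 3 ≤ β)
    (hLβ : β ≤ (L : ℝ)) (hφs : s ^ 2 ≤ 2 * φ) (hLφ : 8 * π / φ ≤ (L : ℝ)) (hA : 0 ≤ A)
    (hF0 : ∀ n, 0 ≤ F n) (hF : ∀ n : ℕ, n < L → 1 / β < g n → g n ≤ φ → A / g n ≤ F n) :
    A * ((L : ℝ) / (8 * π)) * (Real.log β - Real.log (128 / s ^ 3)) ≤
      ∑ n ∈ Finset.range L, F n := by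
  have hπ := Real.pi_pos
  have hs2 : 0 < s ^ 2 := by positivity
  have hs3 : 0 < s ^ 3 := by positivity
  have hs2le : s ^ 2 ≤ 1 := pow_le_one₀ hs.le hs1
  have hs3le : s ^ 3 ≤ 1 := pow_le_one₀ hs.le hs1
  have hLr : (0 : ℝ) < L := lt_of_lt_of_le (by positivity) hL
  have hs3β : 128 ≤ s ^ 3 * β := by
    have h := (div_le_iff₀ hs3).1 hβ
    linarith
  have hβ128 : 128 ≤ β := by
    refine le_trans ?_ hβ
    rw [le_div_iff₀ hs3]
    linarith
  have hβpos : 0 < β := by linarith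
  have hφ : 0 < φ := by linarith
  have hφL : 8 * π ≤ φ * L := by
    have h := (div_le_iff₀ hφ).1 hLφ
    linarith
  obtain ⟨n₀, _hn₀1, hn₀L, hg0, hg1, hcos⟩ := exists_cooperRow_crossing hs hs1 hc hL
  -- the length of the walk and its first kept index
  set R : ℕ := ⌊s ^ 2 * L / 64⌋₊ with hR
  have hRle : (R : ℝ) ≤ s ^ 2 * L / 64 := Nat.floor_le (by positivity)
  have hRge : s ^ 2 * L / 64 < R + 1 := Nat.lt_floor_add_one _
  set j₁ : ℕ := ⌊(L : ℝ) / (s * β)⌋₊ + 1 with hj₁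
  have hj₁gt : (L : ℝ) / (s * β) < j₁ := by
    rw [hj₁]; push_cast; exact Nat.lt_floor_add_one _
  have hsβL : s * β ≤ L := (mul_le_of_le_one_left hβpos.le hs1).trans hLβ
  have hj₁le : (j₁ : ℝ) ≤ 2 * L / (s * β) := by
    rw [hj₁]; push_cast
    have h1 : (⌊(L : ℝ) / (s * β)⌋₊ : ℝ) ≤ L / (s * β) := Nat.floor_le (by positivity)
    have h2 : (1 : ℝ) ≤ L / (s * β) := by
      rw [le_div_iff₀ (by positivity)]
      linarith
    have h3 : 2 * (L : ℝ) / (s * β) = L / (s * β) + L / (s * β) := by ring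
    linarith
  have hj₁pos : 1 ≤ j₁ := by rw [hj₁]; omega
  have h2L : 2 * (L : ℝ) / (s * β) ≤ s ^ 2 * L / 64 := by
    rw [div_le_div_iff₀ (by positivity) (by norm_num)]
    have h := mul_le_mul_of_nonneg_right hs3β hLr.le
    have e : s ^ 2 * (L : ℝ) * (s * β) = s ^ 3 * β * L := by ring
    rw [e]
    linarith
  have hj₁R : j₁ ≤ R + 1 := by
    have : (j₁ : ℝ) ≤ R + 1 := by linarith
    exact_mod_cast this
  -- along the kept walk the energies lie in `(1/β, min(φ, 8πj/L)]`
  have hwalk : ∀ j ∈ Finset.Icc j₁ R,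
      1 / β < g (n₀ + j) ∧ g (n₀ + j) ≤ 8 * π * j / L ∧ g (n₀ + j) ≤ φ := by
    intro j hj
    rw [Finset.mem_Icc] at hj
    obtain ⟨hb1, hb2⟩ := cooperRow_walk_bounds (c := c) hs hs1 hL hn₀L hcos hRle hg0 hg1 hj.2
    rw [← hg (n₀ + j)] at hb1 hb2
    have hjge : (j₁ : ℝ) ≤ j := by exact_mod_cast hj.1
    have hjR : (j : ℝ) ≤ R := by exact_mod_cast hj.2
    have hj1' : (1 : ℝ) ≤ j := le_trans (by exact_mod_cast hj₁pos) hjge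
    refine ⟨?_, ?_, ?_⟩
    · have h1 : (L : ℝ) / (s * β) < j := lt_of_lt_of_le hj₁gt hjge
      rw [div_lt_iff₀ (by positivity)] at h1
      calc 1 / β < s * j / L := by
            rw [div_lt_div_iff₀ hβpos hLr]
            linarith
        _ ≤ g (n₀ + j) := hb1
    · calc g (n₀ + j) ≤ 4 * π * (j + 1) / L := hb2
        _ ≤ 8 * π * j / L := by
            rw [div_le_div_iff_of_pos_right hLr]
            have h := mul_le_mul_of_nonneg_left hj1' (by positivity : (0 : ℝ) ≤ 4 * π)
            linarith
    · have hstep1 : 4 * π * ((j : ℝ) + 1) ≤ 4 * π * (s ^ 2 * L / 64 + 1) := by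
        have h := hjR.trans hRle
        gcongr
      have h5 : π * (s ^ 2 * L) ≤ π * (2 * φ * L) :=
        mul_le_mul_of_nonneg_left (mul_le_mul_of_nonneg_right hφs hLr.le) hπ.le
      have h6 : π * (φ * L) ≤ 3.15 * (φ * L) :=
        mul_le_mul_of_nonneg_right Real.pi_lt_d2.le (by positivity)
      calc g (n₀ + j) ≤ 4 * π * (j + 1) / L := hb2
        _ ≤ φ := by
            rw [div_le_iff₀ hLr]
            linarith
  -- the kept walk stays inside `{0, …, L - 1}`
  have hlt : ∀ j ∈ Finset.Icc j₁ R, n₀ + j < L := by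
    intro j hj
    rw [Finset.mem_Icc] at hj
    have hjL : (j : ℝ) ≤ L / 64 := by
      calc (j : ℝ) ≤ R := by exact_mod_cast hj.2
        _ ≤ s ^ 2 * L / 64 := hRle
        _ ≤ 1 * L / 64 := by gcongr
        _ = L / 64 := by ring
    have h2n : 2 * (n₀ : ℝ) ≤ L := by exact_mod_cast hn₀L
    have : (n₀ : ℝ) + j < L := by linarith
    exact_mod_cast this
  have hsub : (Finset.Icc j₁ R).image (fun j => n₀ + j) ⊆ Finset.range L := by
    intro n hn
    rw [Finset.mem_image] at hn
    obtain ⟨j, hj, rfl⟩ := hn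
    exact Finset.mem_range.2 (hlt j hj)
  have hinj : Set.InjOn (fun j => n₀ + j) ↑(Finset.Icc j₁ R) := fun a _ b _ h => by
    simpa using h
  -- the logarithm
  have hlog : Real.log β - Real.log (128 / s ^ 3) ≤ Real.log (R + 1) - Real.log j₁ := by
    have hA' : Real.log (s ^ 2 * L / 64) ≤ Real.log (R + 1) :=
      Real.log_le_log (by positivity) hRge.le
    have hB : Real.log j₁ ≤ Real.log (2 * L / (s * β)) :=
      Real.log_le_log (by exact_mod_cast (show 0 < j₁ by omega)) hj₁le
    have hC : Real.log (s ^ 2 * L / 64) - Real.log (2 * L / (s * β)) =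
        Real.log β - Real.log (128 / s ^ 3) := by
      rw [← Real.log_div (by positivity) (by positivity), ← Real.log_div (by positivity)
        (by positivity)]
      congr 1
      field_simp
      ring
    linarith
  have hAL : 0 ≤ A * ((L : ℝ) / (8 * π)) := by positivity
  -- the chain
  calc A * ((L : ℝ) / (8 * π)) * (Real.log β - Real.log (128 / s ^ 3))
      ≤ A * ((L : ℝ) / (8 * π)) * (Real.log (R + 1) - Real.log j₁) :=
        mul_le_mul_of_nonneg_left hlog hAL
    _ ≤ A * ((L : ℝ) / (8 * π)) * ∑ j ∈ Finset.Icc j₁ R, (1 : ℝ) / j := by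
        apply mul_le_mul_of_nonneg_left _ hAL
        rw [show Finset.Icc j₁ R = Finset.Ico j₁ (R + 1) by ext; simp]
        have := log_sub_log_le_sum_Ico_one_div hj₁pos hj₁R
        push_cast at this
        exact this
    _ = ∑ j ∈ Finset.Icc j₁ R, A * ((L : ℝ) / (8 * π)) * (1 / j) := by rw [Finset.mul_sum]
    _ ≤ ∑ j ∈ Finset.Icc j₁ R, F (n₀ + j) := by
        refine Finset.sum_le_sum fun j hj => ?_
        obtain ⟨h1, h2, h3⟩ := hwalk j hj
        have hgpos : 0 < g (n₀ + j) := lt_trans (by positivity) h1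
        have hjpos : (0 : ℝ) < j := by
          rw [Finset.mem_Icc] at hj
          exact_mod_cast (show 0 < j by omega)
        refine le_trans ?_ (hF (n₀ + j) (hlt j hj) h1 h3)
        rw [show A * ((L : ℝ) / (8 * π)) * (1 / j) = A * (L / (8 * π * j)) by field_simp,
          div_eq_mul_one_div A (g _)]
        refine mul_le_mul_of_nonneg_left ?_ hA
        rw [div_le_div_iff₀ (by positivity) hgpos, one_mul]
        rw [le_div_iff₀ hLr] at h2
        linarith
    _ = ∑ n ∈ (Finset.Icc j₁ R).image (fun j => n₀ + j), F n := by rw [Finset.sum_image hinj]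
    _ ≤ ∑ n ∈ Finset.range L, F n :=
        Finset.sum_le_sum_of_subset_of_nonneg hsub fun _ _ _ => hF0 _

/-! ### Good rows with a `d`-wave margin -/

/-- **Good rows with a `d`-wave margin.** For `μ ∈ [-4 + d₀, -d₀]` (`d₀ > 0`), `s² ≤ d₀`,
`0 < φ₀ ≤ d₀/4` and `L ≥ 32π/d₀`, at least `d₀L/(32π)` momenta `n ≤ L/2` have BOTH
`|2cos(2πn/L) + μ| ≤ 2 - s²/2` (the row `k₂ = n` crosses the Fermi level transversally) and
`|2cos(2πn/L) + μ/2| ≥ φ₀` (at the crossing the `d`-wave form factor stays away from its node): the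
antitone sequence `cos(2πn/L)`, `0 ≤ n ≤ L/2`, has steps `≤ 2π/L` and passes through the interval
`[t₁, t₁ + d₀/8] ⊂ (0, 1]`, `t₁ = max(-1 + s²/4 - μ/2, φ₀/2 - μ/4)`, of admissible values. [folklore] -/
theorem card_cooperGoodRows_dWave_ge {L : ℕ} {d₀ s φ₀ μ : ℝ} (hd₀ : 0 < d₀) (hμ1 : -4 + d₀ ≤ μ)
    (hμ2 : μ ≤ -d₀) (hs : s ^ 2 ≤ d₀) (hφ₀ : 0 < φ₀) (hφd : φ₀ ≤ d₀ / 4)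
    (hL : 32 * π / d₀ ≤ (L : ℝ)) :
    d₀ * L / (32 * π) ≤
      (((Finset.range (L / 2 + 1)).filter fun n : ℕ =>
          |2 * Real.cos (2 * π * (n : ℝ) / L) + μ| ≤ 2 - s ^ 2 / 2 ∧
            φ₀ ≤ |2 * Real.cos (2 * π * (n : ℝ) / L) + μ / 2|).card : ℝ) := by
  have hπ := Real.pi_pos
  have hπ3 := Real.pi_gt_three
  have hdL : 32 * π ≤ d₀ * L := by
    have h := (div_le_iff₀ hd₀).1 hL
    linarith
  have hd2 : d₀ ≤ 2 := by linarith
  have hL0 : (0 : ℝ) ≤ L := Nat.cast_nonneg L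
  have hLr : (2 : ℝ) ≤ L := by
    have h := mul_le_mul_of_nonneg_right hd2 hL0
    linarith
  have hLpos : (0 : ℝ) < L := by linarith
  have hL2 : 2 ≤ L := by exact_mod_cast hLr
  -- the target interval `[a, a + d₀/8]`
  set a : ℝ := max (-1 + s ^ 2 / 4 - μ / 2) (φ₀ / 2 - μ / 4) with ha
  have ha1 : -1 + s ^ 2 / 4 - μ / 2 ≤ a := le_max_left _ _
  have ha2 : φ₀ / 2 - μ / 4 ≤ a := le_max_right _ _
  have ha_pos : 0 < a := lt_of_lt_of_le (by linarith) ha2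
  have hs0 : 0 ≤ s ^ 2 := sq_nonneg s
  have ha3 : a + d₀ / 8 ≤ 1 := by
    rcases le_total (-1 + s ^ 2 / 4 - μ / 2) (φ₀ / 2 - μ / 4) with h | h
    · rw [ha, max_eq_right h]; linarith
    · rw [ha, max_eq_left h]; linarith
  -- the sequence `cos(2πn/L)`, `0 ≤ n ≤ m = L/2`
  set m : ℕ := L / 2 with hm
  have hstep : ∀ n < m, |Real.cos (2 * π * ((n + 1 : ℕ) : ℝ) / L) -
      Real.cos (2 * π * (n : ℝ) / L)| ≤ 2 * π / L := by
    intro n _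
    have h := Real.abs_cos_sub_cos_le (2 * π * ((n + 1 : ℕ) : ℝ) / L) (2 * π * (n : ℝ) / L)
    rwa [show 2 * π * ((n + 1 : ℕ) : ℝ) / L - 2 * π * (n : ℝ) / L = 2 * π / L by push_cast; ring,
      abs_of_pos (show (0 : ℝ) < 2 * π / L by positivity)] at h
  have hxm : Real.cos (2 * π * (m : ℝ) / L) < a := by
    have h4m : L ≤ 4 * m := by omega
    have h2m : 2 * m ≤ L := by omega
    have h4mr : (L : ℝ) ≤ 4 * m := by exact_mod_cast h4m
    have h2mr : 2 * (m : ℝ) ≤ L := by exact_mod_cast h2m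
    refine lt_of_le_of_lt (Real.cos_nonpos_of_pi_div_two_le_of_le ?_ ?_) ha_pos
    · rw [le_div_iff₀ hLpos]
      have h := mul_le_mul_of_nonneg_left h4mr (by positivity : (0 : ℝ) ≤ π / 2)
      linarith
    · rw [div_le_iff₀ hLpos]
      have h := mul_le_mul_of_nonneg_left h2mr hπ.le
      have h' : 0 ≤ π * L := by positivity
      linarith
  have hx0 : a + d₀ / 8 ≤ Real.cos (2 * π * ((0 : ℕ) : ℝ) / L) := by
    simp only [Nat.cast_zero, mul_zero, zero_div, Real.cos_zero]
    exact ha3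
  have hcount := sub_one_le_card_filter_mem_Icc (x := fun n : ℕ => Real.cos (2 * π * (n : ℝ) / L))
    (by positivity : (0 : ℝ) < 2 * π / L) (by positivity : (0 : ℝ) ≤ d₀ / 8) hstep hxm hx0
  -- the visited points are good rows with margin
  have hsub : ((Finset.range (m + 1)).filter fun n : ℕ =>
      a ≤ Real.cos (2 * π * (n : ℝ) / L) ∧ Real.cos (2 * π * (n : ℝ) / L) ≤ a + d₀ / 8) ⊆
      ((Finset.range (L / 2 + 1)).filter fun n : ℕ =>
          |2 * Real.cos (2 * π * (n : ℝ) / L) + μ| ≤ 2 - s ^ 2 / 2 ∧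
            φ₀ ≤ |2 * Real.cos (2 * π * (n : ℝ) / L) + μ / 2|) := by
    intro n hn
    rw [Finset.mem_filter] at hn ⊢
    refine ⟨hn.1, ?_, ?_⟩
    · rw [abs_le]
      constructor <;> linarith [hn.2.1, hn.2.2]
    · rw [abs_of_pos (by linarith [hn.2.1])]
      linarith [hn.2.1]
  have e : d₀ / 8 / (2 * π / L) = d₀ * L / (16 * π) := by
    field_simp
    norm_num
  calc d₀ * L / (32 * π) ≤ d₀ * L / (16 * π) - 1 := by
        have h32 : 1 ≤ d₀ * L / (32 * π) := by
          rw [le_div_iff₀ (by positivity)]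
          linarith
        have e2 : d₀ * L / (16 * π) = 2 * (d₀ * L / (32 * π)) := by
          field_simp
          ring
        linarith
    _ = d₀ / 8 / (2 * π / L) - 1 := by rw [e]
    _ ≤ _ := hcount
    _ ≤ _ := by exact_mod_cast Finset.card_le_card hsub

end Literature.MathematicalPhysics.QuantumLattice
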